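import Summits.RiemannHypothesis.RiemannHypothesis.Theorems.PfPersistenceBarrierExplicitDatum
import HarnessLib

/-!
# PF-persistence BARRIER — F3-S3: MASS-DELETION TWINS of an arbitrary explicit-formula datum

Framing (page 1 of every `pub-rhpf` file): **long-odds MECHANISM SEARCH — nothing here is a claim
about RH.**  No RH-bearing proposition occurs in this file at all: every statement is about an
ARBITRARY `ExplicitDatum` `E` (smooth part + point masses) and the datum `E.deleteMasses S`
obtained by zeroing the weights indexed by `S`.

Dictionary (documentation only; the identification datum ↔ L-function is the cited explicit
formula, exactly as for `zetaDatum`): for `K = ℚ(√-D)` (`-D` fundamental, class number `h ≥ 2`)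
and `E` = the explicit datum of the Dedekind zeta function `ζ_K` (masses `(1+χ(p)^k) log p · p^{-k/2}`
at `± k log p`), the PRINCIPAL-CLASS PARTIAL ZETA FUNCTION `Z_D(s) = Σ_{𝔞 principal} N𝔞^{-s}`
(= Epstein zeta of the principal form, = `h⁻¹ Σ_ψ L(s,ψ)` over the class-group characters — a
Bombieri–Hejhal linear combination with the functional equation of `ζ_K`) has, below `log(D/4)`,
exactly the datum `E.deleteMasses S` with `S` = the odd powers of the primes that are norms of
NON-principal ideals (elementary: a principal ideal of norm `< D/4` is generated by a rational
integer).  Hence (this file, `deleteMasses_window_eq`): `Z_D` and `ζ_K` have IDENTICAL Weil windows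
`a ≤ A` whenever `2A <` the logarithm of the least such prime (`pub-rhpf` FAKES §3 ADDENDUM gen 2,
family F3-S3; Davenport–Heilbronn 1936: `Z_D` has zeros in `σ > 1`).

Contents: `deleteMasses`; deletions above `B` are an `AgreeBelow`-twin (`agreeBelow_deleteMasses`);
identical quadratic functional / window record / window positivity below half the least deleted
position (`deleteMasses_quadratic_eq`, `deleteMasses_window_eq`, `deleteMasses_positivityOn_iff`);
the W1 instance `deleteMasses_not_discriminates`.  (THEOREM F3-B of the addendum — the
host-generic form of `TailDialRayleighBound` at `K = 0` — is typed in the staging file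
`F3DeletionTwinsTarget.lean` of `pub-rhpf-fake-3` and is NOT part of this file.)
-/

set_option linter.dupNamespace false

noncomputable section

open MeasureTheory Set Filter Complex
open scoped Real Topology

namespace Summit.RiemannHypothesis.RiemannHypothesis.Theorems.PfPersistenceBarrier

open Literature.NumberTheory.LFunctions

namespace ExplicitDatum

open Classical in
/-- The datum `E` with the point masses indexed by `S` DELETED (weights set to `0`; smooth part and
positions unchanged). [folklore] -/
def deleteMasses (E : ExplicitDatum) (S : Set ℕ) : ExplicitDatum where
  smooth := E.smooth
  pos := E.pos
  wt := fun i ↦ if i ∈ S then 0 else E.wt i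

variable {E : ExplicitDatum} {S : Set ℕ}

/-- Deletion keeps the smooth part. [folklore] -/
@[simp] theorem deleteMasses_smooth (E : ExplicitDatum) (S : Set ℕ) :
    (E.deleteMasses S).smooth = E.smooth := rfl

/-- Deletion keeps the positions. [folklore] -/
@[simp] theorem deleteMasses_pos (E : ExplicitDatum) (S : Set ℕ) :
    (E.deleteMasses S).pos = E.pos := rfl

/-- A deleted weight is `0`. [folklore] -/
theorem deleteMasses_wt_of_mem {i : ℕ} (h : i ∈ S) : (E.deleteMasses S).wt i = 0 := by
  classical
  show (if i ∈ S then 0 else E.wt i) = 0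
  rw [if_pos h]

/-- An undeleted weight is unchanged. [folklore] -/
theorem deleteMasses_wt_of_not_mem {i : ℕ} (h : i ∉ S) : (E.deleteMasses S).wt i = E.wt i := by
  classical
  show (if i ∈ S then 0 else E.wt i) = E.wt i
  rw [if_neg h]

/-- Deleting nothing changes nothing. [folklore] -/
@[simp] theorem deleteMasses_empty (E : ExplicitDatum) : E.deleteMasses ∅ = E := by
  cases E
  simp [deleteMasses]

/-- **Deleted masses above `B` are invisible below `B`:** `E` and `E.deleteMasses S` agree below `B`
as soon as every deleted position has modulus `> B`. [folklore] -/
theorem agreeBelow_deleteMasses {B : ℝ} (h : ∀ i ∈ S, B < |E.pos i|) :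
    AgreeBelow E (E.deleteMasses S) B := by
  intro i
  by_cases hi : i ∈ S
  · exact Or.inl ⟨Or.inr (h i hi), Or.inl (deleteMasses_wt_of_mem hi)⟩
  · exact Or.inr ⟨rfl, (deleteMasses_wt_of_not_mem hi).symm⟩

/-- **Mass-deletion twins, quadratic form.** If every deleted position has modulus `> 2A`, the
deleted datum has the same Weil quadratic functional as `E` on every test function supported in
`[-a, a]`, `a ≤ A`. [folklore] -/
theorem deleteMasses_quadratic_eq {A a : ℝ} (h : ∀ i ∈ S, 2 * A < |E.pos i|) (ha : a ≤ A)
    {g : ℝ → ℂ} (hg : tsupport g ⊆ Icc (-a) a) :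
    (E.deleteMasses S).quadratic g = E.quadratic g :=
  (quadratic_eq_of_agreeBelow (agreeBelow_deleteMasses h) rfl ha hg).symm

/-- **Mass-deletion twins, window records.** [folklore] -/
theorem deleteMasses_window_eq {A a : ℝ} (h : ∀ i ∈ S, 2 * A < |E.pos i|) (ha : a ≤ A) :
    (E.deleteMasses S).window a = E.window a :=
  (window_eq_of_agreeBelow (agreeBelow_deleteMasses h) rfl ha).symm

/-- **Mass-deletion twins, window positivity.** Below half the least deleted position, the deleted
datum is window-positive iff the host is. [folklore] -/
theorem deleteMasses_positivityOn_iff {A : ℝ} (h : ∀ i ∈ S, 2 * A < |E.pos i|) :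
    (E.deleteMasses S).PositivityOn A ↔ E.PositivityOn A :=
  (positivityOn_iff_of_agreeBelow (agreeBelow_deleteMasses h) rfl).symm

/-- No window-local predicate up to `A` separates a host from its mass-deletion twin above `2A`
(W1, deletion instance). [folklore] -/
theorem deleteMasses_not_discriminates {P : ExplicitDatum → Prop} {A : ℝ}
    (hP : IsWindowLocal P A) {Neg : Set ExplicitDatum} (hNeg : E.deleteMasses S ∈ Neg)
    (h : ∀ i ∈ S, 2 * A < |E.pos i|) : ¬ Discriminates P E Neg :=
  no_windowLocal_discriminator hP hNeg (agreeBelow_deleteMasses h) rfl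

/-! ### Conductor shifts: one certificate, all smaller conductors

For F3-S3 (documentation): below `x = log(D/4)` the datum of `Z_D` is `U.shiftConductor (log D)` for
ONE datum `U` (pole, `Γ_ℂ`, conductor `1`, masses `2 log p · p^{-j}` at `± 2j log p`), so the Weil
windows `a < ½ log(D/4)` of all the `Z_D` differ by the scalar `log D · ‖g‖₂²` only, and a negative
direction found for one conductor is negative for every smaller one. -/

/-- The datum `E` with the CONDUCTOR SHIFTED: `c · k(0)` added to the smooth part (for an L-datum,
`c = log(Q'/Q)`). [folklore] -/
def shiftConductor (E : ExplicitDatum) (c : ℝ) : ExplicitDatum where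
  smooth := fun k ↦ E.smooth k + c * k 0
  pos := E.pos
  wt := E.wt

/-- The shifted functional: `W_{E,c}(k) = W_E(k) + c·k(0)`. [folklore] -/
theorem shiftConductor_functional (E : ExplicitDatum) (c : ℝ) (k : ℝ → ℂ) :
    (E.shiftConductor c).functional k = E.functional k + c * k 0 := by
  show E.smooth k + (c : ℂ) * k 0 - E.primeTerm k = E.smooth k - E.primeTerm k + c * k 0
  ring

/-- `Re Q_{E,c}(g) = Re Q_E(g) + c‖g‖₂²`. [folklore] -/
theorem shiftConductor_quadratic_re (E : ExplicitDatum) (c : ℝ) (g : ℝ → ℂ) :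
    ((E.shiftConductor c).quadratic g).re = (E.quadratic g).re + c * ∫ t : ℝ, ‖g t‖ ^ 2 := by
  unfold quadratic
  rw [shiftConductor_functional, weilConv_weilReflect_apply_zero]
  simp only [Complex.add_re, Complex.mul_re, Complex.ofReal_re, Complex.ofReal_im, mul_zero,
    sub_zero]

/-- **One certificate, all smaller conductors.** A negative direction of `E` shifted by `c` is a
negative direction of `E` shifted by any `c' ≤ c`. [folklore] -/
theorem shiftConductor_quadratic_re_neg_mono (E : ExplicitDatum) {c c' : ℝ} (h : c' ≤ c)
    {g : ℝ → ℂ} (hneg : ((E.shiftConductor c).quadratic g).re < 0) :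
    ((E.shiftConductor c').quadratic g).re < 0 := by
  rw [shiftConductor_quadratic_re] at hneg ⊢
  have hI : 0 ≤ ∫ t : ℝ, ‖g t‖ ^ 2 := integral_nonneg fun t ↦ by positivity
  nlinarith [mul_le_mul_of_nonneg_right h hI]

/-- Hence window NON-positivity up to `A` descends from conductor shift `c` to every `c' ≤ c`, and
window positivity ascends. [folklore] -/
theorem shiftConductor_positivityOn_mono (E : ExplicitDatum) {c c' : ℝ} (h : c' ≤ c) {A : ℝ}
    (hpos : (E.shiftConductor c').PositivityOn A) : (E.shiftConductor c).PositivityOn A := by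
  intro g hg hs
  by_contra hlt
  exact absurd (hpos g hg hs) (not_le.2 (E.shiftConductor_quadratic_re_neg_mono h (not_le.1 hlt)))

end ExplicitDatum

end Summit.RiemannHypothesis.RiemannHypothesis.Theorems.PfPersistenceBarrier

end
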